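import Literature.MathematicalPhysics.QuantumFieldTheory.PeriodicBoxPartitionFunction
import Summits.QuantumFields.YangMills.Theses.ComplexCouplingChannel

/-!
# Line `Sketch` — skeleton for the crux `TubeZeroFreeChannel` (stmt-QuantumFields-18841)

Lead prover's reshaping (prover-line-stmt-QuantumFields-18841-0) of the ideator-1 sketch
`Cruxes/TubeZeroFreeChannel/Ideator1Sketch.lean` into stub form:

* `stub_crossoverBridge` (LEAD) — the anchor-connected uniformly zero-free region reaches
  arbitrarily large real couplings at SOME points (strategist's `CrossoverBridge`);
* `stub_constantWidthStrip` (WORKER) — beyond `β_c(G, r)` one half-width `δ > 0` serves every weak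
  coupling window `[b, β]` (card `af-transport-constant-width`, C⁺ = `ConstantWidthStrip`);
* `TubeZeroFreeChannel_of : TubeZeroFreeChannel` — the composition (the strategist's proved split
  `CrossoverBridge → WeakCouplingCorridor → crux` with `ConstantWidthStrip → WeakCouplingCorridor`),
  sorry-free apart from the two stubs.

Both stubs are stated over LITERATURE vocabulary only — the box partition function
`(boxSystem r.ρ ![L, L, L, t]).partZ univ z` of `PeriodicBoxPlaqSystem` / `StrongCouplingPolymerSystem`,
identified with the crux's inline `Zc` by `boxSystem_partZ_univ_eq_finTorus`
(`PeriodicBoxPartitionFunction`) — so that a worker's file lands under `Theorems/` without any new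
definition.
-/

set_option autoImplicit false

noncomputable section

namespace Summit.QuantumFields.YangMills.Cruxes.TubeZeroFreeChannel.Sketch

open scoped BigOperators Topology
open MeasureTheory Filter
open Literature.MathematicalPhysics.QuantumFieldTheory (LatticeRep IsCompactSimpleLieGroup
  haarProbability boxSystem boxSystem_partZ_univ_eq_finTorus)
open Summit.QuantumFields.YangMills.Theses.ComplexCouplingChannel (TubeZeroFreeChannel)

/-! ## The two stubs (Literature vocabulary only) -/

/-- STUB (worker) `stub_constantWidthStrip` — card `af-transport-constant-width`, target shape C⁺:
for every compact simple `G` and faithful unitary `r` there are `β_c` and ONE half-width `δ > 0`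
such that for all `β_c ≤ b ≤ β` the box partition functions of the tubes `L³ × t` have no zero in
the `δ`-box about `[b, β]`, for `L ≥ L₀(b, β)` and `t ≥ t₀(L)`. -/
theorem stub_constantWidthStrip :
    ∀ (G : Type) [Group G] [TopologicalSpace G] [IsTopologicalGroup G] [CompactSpace G]
      [MeasurableSpace G] [BorelSpace G], IsCompactSimpleLieGroup G → ∀ r : LatticeRep G,
      ∃ βc δ : ℝ, 0 < δ ∧ ∀ b β : ℝ, βc ≤ b → b ≤ β →
        ∃ L₀ : ℕ, ∀ L : ℕ, L₀ ≤ L → ∃ t₀ : ℕ, ∀ t : ℕ, t₀ ≤ t → ∀ z : ℂ,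
          b - δ < z.re → z.re < β + δ → -δ < z.im → z.im < δ →
          (boxSystem r.ρ (![L, L, L, t] : Fin 4 → ℕ)).partZ Finset.univ z ≠ 0 := by
  sorry

/-- STUB (lead) `stub_crossoverBridge` — the strategist's `CrossoverBridge`: for every compact simple
`G`, faithful unitary `r`, every `b` and every `ρ > 0` there is `β ≥ b` and an open connected
`D ∋ β` containing a real point `|x| < ρ` on which the box partition functions of the tubes
`L³ × t` have no zero for `L ≥ L₀` and `t ≥ t₀(L)`. -/
theorem stub_crossoverBridge :
    ∀ (G : Type) [Group G] [TopologicalSpace G] [IsTopologicalGroup G] [CompactSpace G]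
      [MeasurableSpace G] [BorelSpace G], IsCompactSimpleLieGroup G → ∀ r : LatticeRep G,
      ∀ b ρ : ℝ, 0 < ρ → ∃ β : ℝ, b ≤ β ∧ ∃ D : Set ℂ, IsOpen D ∧ IsConnected D ∧ (β : ℂ) ∈ D ∧
        (∃ x : ℝ, |x| < ρ ∧ (x : ℂ) ∈ D) ∧
        ∃ L₀ : ℕ, ∀ L : ℕ, L₀ ≤ L → ∃ t₀ : ℕ, ∀ t : ℕ, t₀ ≤ t → ∀ z ∈ D,
          (boxSystem r.ρ (![L, L, L, t] : Fin 4 → ℕ)).partZ Finset.univ z ≠ 0 := by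
  sorry

/-! ## Named definitions (strategist / ideator, verbatim) and the dictionary with `partZ` -/

section Defs

variable (G : Type) [Group G] [TopologicalSpace G] [IsTopologicalGroup G] [CompactSpace G]
  [MeasurableSpace G] [BorelSpace G]

/-- The complex-coupling Wilson partition function of the periodic box `a³ × t` in the
representation `r` — verbatim the `let Zc` of the route decl `TubeZeroFreeChannel`. -/
def Zc (r : LatticeRep G) (z : ℂ) (a t : ℕ) : ℂ :=
  let St := Fin a × Fin a × Fin a × Fin t
  let sh : St → Fin 4 → St := fun x μ => ![(finRotate a x.1, x.2.1, x.2.2.1, x.2.2.2),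
    (x.1, finRotate a x.2.1, x.2.2.1, x.2.2.2), (x.1, x.2.1, finRotate a x.2.2.1, x.2.2.2),
    (x.1, x.2.1, x.2.2.1, finRotate t x.2.2.2)] μ
  let pl : (St × Fin 4 → G) → St → Fin 4 → Fin 4 → G := fun U x μ ν =>
    U (x, μ) * U (sh x μ, ν) * (U (sh x ν, μ))⁻¹ * (U (x, ν))⁻¹
  ∫ U, Complex.exp (-(z * ((∑ x : St, ∑ q : {q : Fin 4 × Fin 4 // q.1 < q.2},
    ((r.N : ℝ) - (r.ρ (pl U x q.1.1 q.1.2)).trace.re) : ℝ) : ℂ)))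
    ∂(Measure.pi fun _ : St × Fin 4 => haarProbability G)

/-- DICTIONARY: the inline `Zc` is the Literature box partition function
`(boxSystem r.ρ ![a, a, a, t]).partZ univ z` (`boxSystem_partZ_univ_eq_finTorus`). -/
theorem Zc_eq_partZ (r : LatticeRep G) (z : ℂ) (a t : ℕ) :
    Zc G r z a t = (boxSystem r.ρ (![a, a, a, t] : Fin 4 → ℕ)).partZ Finset.univ z :=
  (boxSystem_partZ_univ_eq_finTorus r.ρ r.continuous a a a t z).symm

/-- Uniform tube zero-freeness on `D`: a cross-section floor `L₀` and, for each `L ≥ L₀`, a length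
floor `t₀(L)` beyond which no tube partition function vanishes anywhere on `D`. -/
def UniformZeroFreeOn (r : LatticeRep G) (D : Set ℂ) : Prop :=
  ∃ L₀ : ℕ, ∀ L : ℕ, L₀ ≤ L → ∃ t₀ : ℕ, ∀ t : ℕ, t₀ ≤ t → ∀ z ∈ D, Zc G r z L t ≠ 0

/-- `D` is an anchor-connected uniformly zero-free channel to `β` at tolerance `ρ`. -/
def IsChannel (r : LatticeRep G) (β ρ : ℝ) (D : Set ℂ) : Prop :=
  IsOpen D ∧ IsConnected D ∧ (β : ℂ) ∈ D ∧ (∃ x : ℝ, |x| < ρ ∧ (x : ℂ) ∈ D) ∧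
    UniformZeroFreeOn G r D

variable {G}

/-- Uniform zero-freeness is stable under binary unions (max of the floors). -/
theorem uniformZeroFreeOn_union (r : LatticeRep G) {D₁ D₂ : Set ℂ}
    (h₁ : UniformZeroFreeOn G r D₁) (h₂ : UniformZeroFreeOn G r D₂) :
    UniformZeroFreeOn G r (D₁ ∪ D₂) := by
  obtain ⟨L₁, hL₁⟩ := h₁
  obtain ⟨L₂, hL₂⟩ := h₂
  refine ⟨max L₁ L₂, fun L hL => ?_⟩
  obtain ⟨t₁, ht₁⟩ := hL₁ L (le_of_max_le_left hL)
  obtain ⟨t₂, ht₂⟩ := hL₂ L (le_of_max_le_right hL)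
  refine ⟨max t₁ t₂, fun t ht z hz => ?_⟩
  rcases hz with hz | hz
  · exact ht₁ t (le_of_max_le_left ht) z hz
  · exact ht₂ t (le_of_max_le_right ht) z hz

end Defs

/-- The crux over the named definitions. -/
def CruxBody : Prop :=
  ∀ (G : Type) [Group G] [TopologicalSpace G] [IsTopologicalGroup G] [CompactSpace G]
    [MeasurableSpace G] [BorelSpace G], IsCompactSimpleLieGroup G → ∀ r : LatticeRep G,
    ∃ β₁ : ℝ, ∀ β : ℝ, β₁ ≤ β → ∀ ρ : ℝ, 0 < ρ → ∃ D : Set ℂ, IsChannel G r β ρ D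

/-- The route decl IS `CruxBody`, definitionally. -/
theorem tubeZeroFreeChannel_iff : TubeZeroFreeChannel ↔ CruxBody := Iff.rfl

/-- Sub₁ `CrossoverBridge` (strategist): the anchor-connected uniformly zero-free region reaches
arbitrarily large real couplings at SOME points. -/
def CrossoverBridge : Prop :=
  ∀ (G : Type) [Group G] [TopologicalSpace G] [IsTopologicalGroup G] [CompactSpace G]
    [MeasurableSpace G] [BorelSpace G], IsCompactSimpleLieGroup G → ∀ r : LatticeRep G,
    ∀ b : ℝ, ∀ ρ : ℝ, 0 < ρ → ∃ β : ℝ, b ≤ β ∧ ∃ D : Set ℂ, IsChannel G r β ρ D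

/-- Sub₂ `WeakCouplingCorridor` (strategist): beyond some `β_c(G, r)` any two real couplings are
joined by an open connected uniformly zero-free set. -/
def WeakCouplingCorridor : Prop :=
  ∀ (G : Type) [Group G] [TopologicalSpace G] [IsTopologicalGroup G] [CompactSpace G]
    [MeasurableSpace G] [BorelSpace G], IsCompactSimpleLieGroup G → ∀ r : LatticeRep G,
    ∃ βc : ℝ, ∀ b β : ℝ, βc ≤ b → βc ≤ β → ∃ D : Set ℂ, IsOpen D ∧ IsConnected D ∧
      (b : ℂ) ∈ D ∧ (β : ℂ) ∈ D ∧ UniformZeroFreeOn G r D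

/-- The split glue (strategist, sorry-free; concluded as `CruxBody` so that only
`TubeZeroFreeChannel_of` names the crux): bridge to some `b ≥ β_c`, then the corridor from `b`
to `β`; the union of two open connected uniformly zero-free sets through the common real point `b`
is a channel. -/
theorem cruxBody_of_split :
    CrossoverBridge → WeakCouplingCorridor → CruxBody := by
  intro hB hC G _ _ _ _ _ _ hG r
  obtain ⟨βc, hc⟩ := hC G hG r
  refine ⟨βc, fun β hβ ρ hρ => ?_⟩
  obtain ⟨b, hb, D₁, ho₁, hc₁, hb₁, ⟨x, hx, hxD⟩, hz₁⟩ := hB G hG r βc ρ hρ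
  obtain ⟨D₂, ho₂, hc₂, hb₂, hβ₂, hz₂⟩ := hc b β hb hβ
  exact ⟨D₁ ∪ D₂, ho₁.union ho₂, IsConnected.union ⟨(b : ℂ), hb₁, hb₂⟩ hc₁ hc₂, Or.inr hβ₂,
    ⟨x, hx, Or.inl hxD⟩, uniformZeroFreeOn_union r hz₁ hz₂⟩

/-! ## Card `af-transport-constant-width`: the box, C⁺, and its glue (ideator, sorry-free) -/

/-- The `δ`-box around the real segment `[b, β]`. -/
def box (b β δ : ℝ) : Set ℂ := {z : ℂ | b - δ < z.re ∧ z.re < β + δ ∧ -δ < z.im ∧ z.im < δ}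

/-- The box is open. -/
theorem isOpen_box (b β δ : ℝ) : IsOpen (box b β δ) :=
  (isOpen_lt continuous_const Complex.continuous_re).inter
    ((isOpen_lt Complex.continuous_re continuous_const).inter
      ((isOpen_lt continuous_const Complex.continuous_im).inter
        (isOpen_lt Complex.continuous_im continuous_const)))

/-- The box is convex. -/
theorem convex_box (b β δ : ℝ) : Convex ℝ (box b β δ) :=
  (convex_halfSpace_re_gt (b - δ)).inter ((convex_halfSpace_re_lt (β + δ)).inter
    ((convex_halfSpace_im_gt (-δ)).inter (convex_halfSpace_im_lt δ)))

/-- Real points of `[b, β]` lie in the box. -/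
theorem ofReal_mem_box {b β δ x : ℝ} (hδ : 0 < δ) (hbx : b ≤ x) (hxβ : x ≤ β) :
    (x : ℂ) ∈ box b β δ := by
  refine ⟨?_, ?_, ?_, ?_⟩ <;>
    simp only [Complex.ofReal_re, Complex.ofReal_im] <;> linarith

/-- TARGET SHAPE C⁺ of the AF-transport line: beyond `β_c(G, r)` a single `δ > 0` serves every pair
of weak couplings. -/
def ConstantWidthStrip : Prop :=
  ∀ (G : Type) [Group G] [TopologicalSpace G] [IsTopologicalGroup G] [CompactSpace G]
    [MeasurableSpace G] [BorelSpace G], IsCompactSimpleLieGroup G → ∀ r : LatticeRep G,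
    ∃ βc : ℝ, ∃ δ : ℝ, 0 < δ ∧ ∀ b β : ℝ, βc ≤ b → b ≤ β → UniformZeroFreeOn G r (box b β δ)

/-- Card glue (ideator, sorry-free): the constant-width strip is a weak-coupling corridor. -/
theorem weakCouplingCorridor_of_constantWidthStrip (h : ConstantWidthStrip) :
    WeakCouplingCorridor := by
  intro G _ _ _ _ _ _ hG r
  obtain ⟨βc, δ, hδ, hz⟩ := h G hG r
  refine ⟨βc, fun b β hb hβ => ⟨box (min b β) (max b β) δ, isOpen_box _ _ _,
    (convex_box _ _ _).isConnected ⟨(b : ℂ), ofReal_mem_box hδ (min_le_left _ _) (le_max_left _ _)⟩,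
    ofReal_mem_box hδ (min_le_left _ _) (le_max_left _ _),
    ofReal_mem_box hδ (min_le_right _ _) (le_max_right _ _),
    hz _ _ (le_min hb hβ) (min_le_max)⟩⟩

/-! ## From the stubs to the named statements, and the composition -/

/-- The worker's stub gives C⁺ (dictionary `Zc_eq_partZ`). -/
theorem constantWidthStrip_of_stub : ConstantWidthStrip := by
  intro G _ _ _ _ _ _ hG r
  obtain ⟨βc, δ, hδ, h⟩ := stub_constantWidthStrip G hG r
  refine ⟨βc, δ, hδ, fun b β hb hbβ => ?_⟩
  obtain ⟨L₀, hL⟩ := h b β hb hbβ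
  refine ⟨L₀, fun L hLL => ?_⟩
  obtain ⟨t₀, ht⟩ := hL L hLL
  refine ⟨t₀, fun t htt z hz => ?_⟩
  rw [Zc_eq_partZ]
  exact ht t htt z hz.1 hz.2.1 hz.2.2.1 hz.2.2.2

/-- The lead's stub gives the strategist's `CrossoverBridge` (dictionary `Zc_eq_partZ`). -/
theorem crossoverBridge_of_stub : CrossoverBridge := by
  intro G _ _ _ _ _ _ hG r b ρ hρ
  obtain ⟨β, hbβ, D, hDo, hDc, hβD, hx, L₀, hL⟩ := stub_crossoverBridge G hG r b ρ hρ
  refine ⟨β, hbβ, D, hDo, hDc, hβD, hx, L₀, fun L hLL => ?_⟩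
  obtain ⟨t₀, ht⟩ := hL L hLL
  refine ⟨t₀, fun t htt z hz => ?_⟩
  rw [Zc_eq_partZ]
  exact ht t htt z hz

/-- COMPOSITION: the line `Sketch` closes the crux BY NAME modulo its two stubs —
bridge (`stub_crossoverBridge`) + constant-width strip (`stub_constantWidthStrip`) ⇒ corridor ⇒
`TubeZeroFreeChannel` through the strategist's split. -/
theorem TubeZeroFreeChannel_of : TubeZeroFreeChannel :=
  tubeZeroFreeChannel_iff.mpr (cruxBody_of_split crossoverBridge_of_stub
    (weakCouplingCorridor_of_constantWidthStrip constantWidthStrip_of_stub))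

end Summit.QuantumFields.YangMills.Cruxes.TubeZeroFreeChannel.Sketch
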